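/-
Copyright (c) 2026 the pub-hodgecm-mathlib formalisation cell (harness21).  Prover seat hodgecm-mathlib-K2E3-p36 (g3), HCML Track B «K2-LIT» ∕ h413
(`stmt-HodgeConjecture-24833`), R90-TF section S3, (U3-F) assembly layer B2 at the prime `2` «the DYADIC LOCAL PLANTING DATUM» (captain's skeleton
`R90/S3/SKELETON-P8-AuxGlobaliseField.K2E3-p17-g11.md`, step B2, `p = 2` sub-case; dealer R90-C12-plan (g2) 01:21:43Z).  2026-09-05.
-/
import Summits.HodgeConjecture.HodgeConjecture.Theorems.R90S3LocalPlantingDatum   -- ★ B2 (K2E3-p17): `exists_generator_sq_class`, `exists_scaled_generator`, `one_add_pow_ne`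
import Mathlib.NumberTheory.Padics.RingHoms
import HarnessLib

/-!
# R90-TF · S3 · THEOREMS — `R90S3LocalPlantingDatumTwo` ((U3-F) assembly, layer B2 at `p = 2`): `r ∈ {1,2,3}` DISTINCT units `cᵢ ≡ 1 (mod 4)` of `ℤ₂` with
# PRESCRIBED PRODUCT, the PARITY of `r` making `(−1)^r u⁻¹ ≡ 1 (mod 4)` with `d₀ + r ≥ 3`, and the dyadic local planting datum with `H(0) = 2^a` EXACTLY

R90-TF section S3 (dealer R90-C12-plan (g2)); crux H413 (`stmt-HodgeConjecture-24833`, lane `--supports … --as helper`), route `HCCMUnconditional`.  The `p = 2`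
twin of ★ B2 `R90S3LocalPlantingDatum` §3–§4.  At `p = 2` the extra unit roots `cᵢ` of the planted polynomial `H := h₀ · ∏ (X − cᵢ)` ARE the dyadic data of the
(U3-F) assembly: the planted field acquires `r` degree-one dyadic places at which the planted generator is `≡ cᵢ`, and unramifiedness of `√α` there wants
`cᵢ ≡ 1 (mod 4)` (classes mod `8` free in `{1, 5}`).  Since `≡ 1 (mod 4)` is multiplicative, the prescribed product `t = ∏ cᵢ` must itself be `≡ 1 (mod 4)`;
with `h₀(0) = 2^a · u` (Mathlib `PadicInt.unitCoeff_spec`) and `t := (−1)^r u⁻¹` this is a PARITY CONDITION on `r`, met inside `r ∈ {1,2,3}` together with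
`d₀ + r ≥ 3` (§3).  OUTPUT (§4 **`exists_localPlantingDatum_two`**): B2's generator `y = m s²`, the monic `h₀ ∈ ℤ₂[X]` (degree `d₀ = [K:ℚ₂]`, lower coefficients
of norm `< 1`, no unit root), `r ∈ {1,2,3}` with `d₀ + r ≥ 3`, and an injective `c : Fin r → ℤ₂` of units with `toZModPow 2 (cᵢ) = 1` (equivalently `4 ∣ cᵢ − 1`,
both clauses delivered) and `h₀(0) · ∏ (−cᵢ) = 2^{v(h₀(0))}`.  Consumers: B4 at `p = 2` (`R90S3PlantingTargets`, K2E3-p21) and B6 (K2E4-p14).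
★∕Mathlib-only imports; THEOREMS ONLY (no `def`, no `instance`, no notation, no named fact, no `sorry`); never imports `Cruxes/…/Lines`.

THE MATHEMATICS [folklore].  (§1) `toZModPow 2 : ℤ₂ →+* ℤ∕4` has kernel `4ℤ₂` (Mathlib `PadicInt.ker_toZModPow`); elements `≡ 1 (mod 4)` are units; a unit maps to
a unit of `ℤ∕4`, i.e. to `±1`, and its inverse to the same sign.  (§2) `5 = 1+2², 9 = 1+2³, 17 = 1+2⁴` are `≡ 1 (mod 4)`, pairwise distinct, never opposite and `≠ 1`
(★ B2 `one_add_pow_ne` at `p = 2`); so for any `t` some `κ` among them has `κ ≠ t`, `κ² ≠ t`, and the tuples `(t)`, `(tκ⁻¹, κ)`, `(tκ⁻¹, κ, 1)` are injective,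
`≡ 1 (mod 4)` termwise when `t ≡ 1 (mod 4)`, with product `t`.  (§3) `u ≡ 1 (mod 4)`: take `r = 2`; `u ≡ −1`: take `r = 1` if `d₀ ≥ 2` and `r = 3` if `d₀ = 1`.
(§4) = ★ B2 §1–§2 at `p = 2` + §2–§3 with `u := unitCoeff (h₀(0))`, `h₀(0) ≠ 0` because it maps to the constant coefficient of `minpoly y`, `y ≠ 0`.

HONEST LABEL: HC_CM is proved only modulo the 7 printed citations (2 remaining named inputs: hLiu418 = stmt-HodgeConjecture-24832, h413 =
stmt-HodgeConjecture-24833) until rung 0 closes; local algebra for a sub-step of a GENUINE residual ((U3-F)); proves nothing printed; count-neutral.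
References: [NeukirchANT1999] Ch. II (5.7), (8.2)–(8.4); [Serre1979] Ch. II §5, Ch. XIV §4.
-/

set_option autoImplicit false
-- the mandated namespace repeats the single-problem summit's segment (`HodgeConjecture.HodgeConjecture`)
set_option linter.dupNamespace false

noncomputable section

namespace Summit.HodgeConjecture.HodgeConjecture.R90.S3

open Polynomial IntermediateField Topology IsDedekindDomain NumberField

/-! ## §1 `≡ 1 (mod 4)` in `ℤ₂`: `PadicInt.toZModPow 2` bookkeeping -/

section DyadicCongruence

/-- `x ≡ 1 (mod 4)` in `ℤ₂` in its two spellings: `toZModPow 2 x = 1 ↔ 4 ∣ x − 1` (Mathlib `PadicInt.ker_toZModPow`). [folklore] -/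
theorem toZModPow_two_eq_one_iff (x : ℤ_[2]) : PadicInt.toZModPow 2 x = 1 ↔ (4 : ℤ_[2]) ∣ x - 1 := by
  rw [← sub_eq_zero, ← map_one (PadicInt.toZModPow 2 : ℤ_[2] →+* ZMod (2 ^ 2)), ← map_sub, ← RingHom.mem_ker,
    PadicInt.ker_toZModPow, Ideal.mem_span_singleton]
  norm_num

/-- Elements `≡ 1 (mod 4)` of `ℤ₂` are units (a non-unit of `ℤ₂` is divisible by `2`: Mathlib `PadicInt.mem_nonunits`, `PadicInt.norm_lt_one_iff_dvd`).
[folklore] -/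
theorem isUnit_of_toZModPow_two_eq_one {x : ℤ_[2]} (hx : PadicInt.toZModPow 2 x = 1) : IsUnit x := by
  obtain ⟨y, hy⟩ := (toZModPow_two_eq_one_iff x).1 hx
  by_contra h
  have hlt : ‖x‖ < 1 := PadicInt.mem_nonunits.1 (mem_nonunits_iff.2 h)
  obtain ⟨z, hz⟩ : (2 : ℤ_[2]) ∣ x := by exact_mod_cast (PadicInt.norm_lt_one_iff_dvd x).1 hlt
  have h1 : (2 : ℤ_[2]) ∣ 1 := ⟨z - 2 * y, by linear_combination hz - hy⟩
  have h1' : ‖(1 : ℤ_[2])‖ < 1 := (PadicInt.norm_lt_one_iff_dvd 1).2 (by exact_mod_cast h1)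
  simp at h1'

/-- Units of `ℤ₂` are `≡ ±1 (mod 4)`, a unit and its inverse with the same sign: the image of `u · u⁻¹ = 1` in `ℤ∕4`. [folklore] -/
theorem toZModPow_two_units (u : ℤ_[2]ˣ) :
    (PadicInt.toZModPow 2 (u : ℤ_[2]) = 1 ∧ PadicInt.toZModPow 2 (↑u⁻¹ : ℤ_[2]) = 1) ∨
      (PadicInt.toZModPow 2 (u : ℤ_[2]) = -1 ∧ PadicInt.toZModPow 2 (↑u⁻¹ : ℤ_[2]) = -1) := by
  have h : PadicInt.toZModPow 2 (u : ℤ_[2]) * PadicInt.toZModPow 2 (↑u⁻¹ : ℤ_[2]) = 1 := by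
    rw [← map_mul, Units.mul_inv, map_one]
  have key : ∀ a b : ZMod (2 ^ 2), a * b = 1 → (a = 1 ∧ b = 1) ∨ (a = -1 ∧ b = -1) := by decide
  exact key _ _ h

end DyadicCongruence

/-! ## §2 Distinct units `≡ 1 (mod 4)` of `ℤ₂` with prescribed product (`r ∈ {1,2,3}`) -/

section UnitsTwo

/-- `1 + 2^k ≡ 1 (mod 4)` for `k ≥ 2`. [folklore] -/
theorem toZModPow_two_one_add_pow (k : ℕ) (hk : 2 ≤ k) : PadicInt.toZModPow 2 (1 + (2 : ℤ_[2]) ^ k) = 1 := by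
  rw [toZModPow_two_eq_one_iff, add_sub_cancel_left]
  obtain ⟨j, rfl⟩ := Nat.exists_eq_add_of_le hk
  exact ⟨2 ^ j, by rw [pow_add]; norm_num⟩

/-- **A unit `κ ≡ 1 (mod 4)` avoiding `1`, `t` and `√t`.**  One of `5 = 1+2², 9 = 1+2³, 17 = 1+2⁴` is `≠ t` with square `≠ t` (the three are pairwise distinct and
never opposite — ★ B2 `one_add_pow_ne` at `p = 2` — so at most one equals `t` and at most one squares to `t`); all are `≡ 1 (mod 4)` and `≠ 1`. [folklore] -/
theorem exists_unit_toZModPow_two_eq_one_ne_sq_ne (t : ℤ_[2]) :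
    ∃ κ : ℤ_[2], PadicInt.toZModPow 2 κ = 1 ∧ κ ≠ 1 ∧ κ ≠ t ∧ κ ^ 2 ≠ t := by
  -- ★ B2 at `p = 2` (`((2 : ℕ) : ℤ_[2])` is the numeral `2`)
  have hne : ∀ i j : ℕ, (i ≠ j → (1 + (2 : ℤ_[2]) ^ i) ≠ 1 + (2 : ℤ_[2]) ^ j) ∧ (1 + (2 : ℤ_[2]) ^ i) ≠ -(1 + (2 : ℤ_[2]) ^ j) :=
    fun i j => one_add_pow_ne 2 i j
  have h1 : ∀ k, 2 ≤ k → PadicInt.toZModPow 2 (1 + (2 : ℤ_[2]) ^ k) = 1 ∧ (1 + (2 : ℤ_[2]) ^ k) ≠ 1 := fun k hk =>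
    ⟨toZModPow_two_one_add_pow k hk, fun h => by
      have h' : ((2 ^ k : ℕ) : ℤ_[2]) = 0 := by push_cast; linear_combination h
      have h'' : (2 ^ k : ℕ) = 0 := by exact_mod_cast h'
      exact pow_ne_zero k two_ne_zero h''⟩
  -- two distinct candidates cannot both square to `t`
  have hsq : ∀ i j, i ≠ j → (1 + (2 : ℤ_[2]) ^ i) ^ 2 = t → (1 + (2 : ℤ_[2]) ^ j) ^ 2 ≠ t := by
    intro i j hij hi hj
    have h0 : ((1 + (2 : ℤ_[2]) ^ i) - (1 + (2 : ℤ_[2]) ^ j)) * ((1 + (2 : ℤ_[2]) ^ i) + (1 + (2 : ℤ_[2]) ^ j)) = 0 := by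
      linear_combination hi - hj
    rcases mul_eq_zero.1 h0 with h | h
    · exact (hne i j).1 hij (sub_eq_zero.1 h)
    · exact (hne i j).2 (eq_neg_of_add_eq_zero_left h)
  by_cases h2 : (1 + (2 : ℤ_[2]) ^ 2) ≠ t ∧ (1 + (2 : ℤ_[2]) ^ 2) ^ 2 ≠ t
  · exact ⟨_, (h1 2 le_rfl).1, (h1 2 le_rfl).2, h2.1, h2.2⟩
  by_cases h3 : (1 + (2 : ℤ_[2]) ^ 3) ≠ t ∧ (1 + (2 : ℤ_[2]) ^ 3) ^ 2 ≠ t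
  · exact ⟨_, (h1 3 (by norm_num)).1, (h1 3 (by norm_num)).2, h3.1, h3.2⟩
  by_cases h4 : (1 + (2 : ℤ_[2]) ^ 4) ≠ t ∧ (1 + (2 : ℤ_[2]) ^ 4) ^ 2 ≠ t
  · exact ⟨_, (h1 4 (by norm_num)).1, (h1 4 (by norm_num)).2, h4.1, h4.2⟩
  exfalso
  rw [not_and_or, not_not, not_not] at h2 h3 h4
  -- three bad candidates: two share a type
  rcases h2 with h2 | h2 <;> rcases h3 with h3 | h3 <;> rcases h4 with h4 | h4
  · exact (hne 2 3).1 (by norm_num) (h2.trans h3.symm)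
  · exact (hne 2 3).1 (by norm_num) (h2.trans h3.symm)
  · exact (hne 2 4).1 (by norm_num) (h2.trans h4.symm)
  · exact hsq 3 4 (by norm_num) h3 h4
  · exact (hne 3 4).1 (by norm_num) (h3.trans h4.symm)
  · exact hsq 2 4 (by norm_num) h2 h4
  · exact hsq 2 3 (by norm_num) h2 h3
  · exact hsq 2 3 (by norm_num) h2 h3

/-- **`r ∈ {1,2,3}` DISTINCT units `≡ 1 (mod 4)` of `ℤ₂` with PRESCRIBED PRODUCT `t ≡ 1 (mod 4)`** — the `p = 2` twin of ★ B2 `exists_units_injective_prod_eq`: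
the tuples `(t)`, `(t κ⁻¹, κ)`, `(t κ⁻¹, κ, 1)` with `κ` from `exists_unit_toZModPow_two_eq_one_ne_sq_ne`; `≡ 1 (mod 4)` is multiplicative, so every entry is
`≡ 1 (mod 4)` (both spellings delivered; classes mod `8` lie in `{1, 5}` and are not prescribed). [folklore] -/
theorem exists_units_injective_prod_eq_two (t : ℤ_[2]ˣ) (ht : PadicInt.toZModPow 2 (t : ℤ_[2]) = 1) (r : ℕ) (hr1 : 1 ≤ r) (hr3 : r ≤ 3) :
    ∃ c : Fin r → ℤ_[2], (∀ i, IsUnit (c i)) ∧ Function.Injective c ∧ (∀ i, PadicInt.toZModPow 2 (c i) = 1) ∧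
      (∀ i, (4 : ℤ_[2]) ∣ c i - 1) ∧ ∏ i, c i = (t : ℤ_[2]) := by
  -- the unit clause and the `4 ∣ cᵢ − 1` clause follow from the `toZModPow` clause (§1)
  suffices h : ∃ c : Fin r → ℤ_[2], Function.Injective c ∧ (∀ i, PadicInt.toZModPow 2 (c i) = 1) ∧ ∏ i, c i = (t : ℤ_[2]) by
    obtain ⟨c, hci, hc1, hcp⟩ := h
    exact ⟨c, fun i => isUnit_of_toZModPow_two_eq_one (hc1 i), hci, hc1, fun i => (toZModPow_two_eq_one_iff (c i)).1 (hc1 i), hcp⟩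
  obtain ⟨κ, hκ4, hκ1, hκt, hκsq⟩ := exists_unit_toZModPow_two_eq_one_ne_sq_ne (t : ℤ_[2])
  obtain ⟨κu, rfl⟩ := isUnit_of_toZModPow_two_eq_one hκ4
  -- `κ⁻¹ ≡ 1` and `t κ⁻¹ ≡ 1 (mod 4)`
  have hκinv : PadicInt.toZModPow 2 (↑κu⁻¹ : ℤ_[2]) = 1 := by
    rcases toZModPow_two_units κu with h | h
    · exact h.2
    · exact absurd (h.1.symm.trans hκ4) (by decide)
  have htκ : PadicInt.toZModPow 2 ((t : ℤ_[2]) * (↑κu⁻¹ : ℤ_[2])) = 1 := by rw [map_mul, ht, hκinv, one_mul]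
  -- the three shapes
  have hne12 : (t : ℤ_[2]) * ↑κu⁻¹ ≠ κu := by
    intro h; apply hκsq
    calc (κu : ℤ_[2]) ^ 2 = ((t : ℤ_[2]) * ↑κu⁻¹) * κu := by rw [h, sq]
      _ = t := by rw [mul_assoc, Units.inv_mul, mul_one]
  have hne13 : (t : ℤ_[2]) * ↑κu⁻¹ ≠ 1 := by
    intro h; apply hκt
    calc (κu : ℤ_[2]) = ((t : ℤ_[2]) * ↑κu⁻¹) * κu := by rw [h, one_mul]
      _ = t := by rw [mul_assoc, Units.inv_mul, mul_one]
  rcases Nat.lt_trichotomy r 2 with hr | rfl | hr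
  · obtain rfl : r = 1 := by omega
    exact ⟨fun _ => t, fun i j _ => Subsingleton.elim i j, fun _ => ht, by simp⟩
  · refine ⟨![(t : ℤ_[2]) * ↑κu⁻¹, κu], ?_, ?_, ?_⟩
    · intro i j hij
      fin_cases i <;> fin_cases j
      · rfl
      · exact absurd hij hne12
      · exact absurd hij.symm hne12
      · rfl
    · intro i; fin_cases i
      · exact htκ
      · exact hκ4
    · simp [Fin.prod_univ_two, mul_assoc, Units.inv_mul]
  · obtain rfl : r = 3 := by omega
    refine ⟨![(t : ℤ_[2]) * ↑κu⁻¹, κu, 1], ?_, ?_, ?_⟩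
    · intro i j hij
      fin_cases i <;> fin_cases j
      · rfl
      · exact absurd hij hne12
      · exact absurd hij hne13
      · exact absurd hij.symm hne12
      · rfl
      · exact absurd hij hκ1
      · exact absurd hij.symm hne13
      · exact absurd hij.symm hκ1
      · rfl
    · intro i; fin_cases i
      · exact htκ
      · exact hκ4
      · exact map_one _
    · simp [Fin.prod_univ_three, mul_assoc, Units.inv_mul]

end UnitsTwo

/-! ## §3 The parity of `r` at `p = 2`: `(−1)^r u⁻¹ ≡ 1 (mod 4)` with `d₀ + r ≥ 3` -/

section Parity

/-- **Choice of `r ∈ {1,2,3}` at `p = 2`.**  For a unit `u ∈ ℤ₂^×` and `d₀ ≥ 1` there is `r ∈ {1,2,3}` with `d₀ + r ≥ 3` and `(−1)^r u⁻¹ ≡ 1 (mod 4)`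
(`u ≡ 1 (mod 4)`: `r = 2`; `u ≡ −1`: `r = 1` if `d₀ ≥ 2`, `r = 3` if `d₀ = 1`). [folklore] -/
theorem exists_length_toZModPow_two (u : ℤ_[2]ˣ) {d₀ : ℕ} (hd₀ : 1 ≤ d₀) :
    ∃ r : ℕ, 1 ≤ r ∧ r ≤ 3 ∧ 3 ≤ d₀ + r ∧ PadicInt.toZModPow 2 ((-1) ^ r * (↑u⁻¹ : ℤ_[2])) = 1 := by
  rcases toZModPow_two_units u with h | h
  · exact ⟨2, by norm_num, by norm_num, by omega, by rw [map_mul, map_pow, map_neg, map_one, h.2]; norm_num⟩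
  · by_cases hd : 2 ≤ d₀
    · exact ⟨1, le_rfl, by norm_num, by omega, by rw [map_mul, map_pow, map_neg, map_one, h.2]; norm_num⟩
    · exact ⟨3, by norm_num, le_rfl, by omega, by rw [map_mul, map_pow, map_neg, map_one, h.2]; norm_num⟩

/-- **DYADIC UNIT DATA, consumer form.**  For `u ∈ ℤ₂^×` (the unit part of `h₀(0) = 2^a · u`) and `d₀ ≥ 1`: `r ∈ {1,2,3}` with `d₀ + r ≥ 3` and an injective
`c : Fin r → ℤ₂` of units `≡ 1 (mod 4)` (both spellings) with `u · ∏ (−cᵢ) = 1` — so `H := h₀ · ∏ (X − cᵢ)` has `H(0) = h₀(0) · ∏ (−cᵢ) = 2^a` EXACTLY.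
(`t := (−1)^r u⁻¹` from `exists_length_toZModPow_two`, then `exists_units_injective_prod_eq_two`, and `∏ (−cᵢ) = (−1)^r ∏ cᵢ`.) [folklore] -/
theorem exists_units_mul_prod_neg_eq_one_two (u : ℤ_[2]ˣ) {d₀ : ℕ} (hd₀ : 1 ≤ d₀) :
    ∃ (r : ℕ) (c : Fin r → ℤ_[2]), 1 ≤ r ∧ r ≤ 3 ∧ 3 ≤ d₀ + r ∧ (∀ i, IsUnit (c i)) ∧ Function.Injective c ∧
      (∀ i, PadicInt.toZModPow 2 (c i) = 1) ∧ (∀ i, (4 : ℤ_[2]) ∣ c i - 1) ∧ (u : ℤ_[2]) * ∏ i, (-c i) = 1 := by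
  obtain ⟨r, hr1, hr3, hd, ht⟩ := exists_length_toZModPow_two u hd₀
  -- the prescribed product, as a unit
  have htval : (((-1 : ℤ_[2]ˣ) ^ r * u⁻¹ : ℤ_[2]ˣ) : ℤ_[2]) = (-1) ^ r * ↑u⁻¹ := by simp
  obtain ⟨c, hcu, hci, hc1, hc4, hcp⟩ := exists_units_injective_prod_eq_two ((-1) ^ r * u⁻¹) (by rw [htval]; exact ht) r hr1 hr3
  refine ⟨r, c, hr1, hr3, hd, hcu, hci, hc1, hc4, ?_⟩
  calc (u : ℤ_[2]) * ∏ i, (-c i) = (u : ℤ_[2]) * ((-1) ^ r * ∏ i, c i) := by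
        rw [Finset.prod_neg, Finset.card_univ, Fintype.card_fin]
    _ = (u : ℤ_[2]) * ((-1) ^ r * ((-1) ^ r * ↑u⁻¹)) := by rw [hcp, htval]
    _ = ((-1 : ℤ_[2]) ^ r) ^ 2 * ((u : ℤ_[2]) * ↑u⁻¹) := by ring
    _ = 1 := by rw [Units.mul_inv, mul_one, ← pow_mul, pow_mul', neg_one_sq, one_pow]

end Parity

/-! ## §4 The dyadic local planting datum -/

section Datum

variable {L : Type} [Field L] [NumberField L] (w : HeightOneSpectrum (𝓞 L))
  [Algebra ℚ_[2] (w.adicCompletion L)] [FiniteDimensional ℚ_[2] (w.adicCompletion L)]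

/-- **THE DYADIC LOCAL PLANTING DATUM (B2 at `p = 2`).**  At `K = L_w` with a continuous finite `ℚ₂`-structure and `ι : K →ₐ[ℚ₂] Q̄₂`, for `m ≠ 0`: a non-zero
GENERATOR `y = m s²` of `K ∕ ℚ₂`; a monic `h₀ ∈ ℤ₂[X]` of degree `d₀ = [K : ℚ₂]` mapping to `minpoly_{ℚ₂} y`, all lower coefficients of norm `< 1` (so no unit of
`ℤ₂` is a root of `h₀`); `r ∈ {1,2,3}` with `d₀ + r ≥ 3`; and an injective `c : Fin r → ℤ₂` of units `≡ 1 (mod 4)` (both spellings) such that `h₀(0) ≠ 0` and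
`h₀(0) · ∏ (−cᵢ) = 2^{v(h₀(0))}` — i.e. `H := h₀ · ∏ (X − C cᵢ)` (monic, separable, `ℤ₂`-coefficients, degree `d₀ + r ≥ 3`) has constant term a power of `2`
EXACTLY (census (C0)); here `r` and `c` are OUTPUT, chosen by §3 from the unit part of `h₀(0)` (Mathlib `PadicInt.unitCoeff_spec`).
[cite: NeukirchANT1999, Ch. II (8.2)-(8.4)] [cite: Serre1979, Ch. II §5] -/
theorem exists_localPlantingDatum_two (hc : Continuous (algebraMap ℚ_[2] (w.adicCompletion L))) (ι : w.adicCompletion L →ₐ[ℚ_[2]] PadicAlgCl 2)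
    {m : w.adicCompletion L} (hm : m ≠ 0) :
    ∃ (y s : w.adicCompletion L) (h₀ : ℤ_[2][X]) (r : ℕ) (c : Fin r → ℤ_[2]),
      y ≠ 0 ∧ y = m * s ^ 2 ∧ ℚ_[2]⟮y⟯ = ⊤ ∧
      h₀.Monic ∧ h₀.natDegree = Module.finrank ℚ_[2] (w.adicCompletion L) ∧ h₀.map (algebraMap ℤ_[2] ℚ_[2]) = minpoly ℚ_[2] y ∧
      (∀ i, i < h₀.natDegree → ‖h₀.coeff i‖ < 1) ∧ (∀ u : ℤ_[2], IsUnit u → ¬ h₀.IsRoot u) ∧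
      1 ≤ r ∧ r ≤ 3 ∧ 3 ≤ h₀.natDegree + r ∧
      (∀ i, IsUnit (c i)) ∧ Function.Injective c ∧ (∀ i, PadicInt.toZModPow 2 (c i) = 1) ∧ (∀ i, (4 : ℤ_[2]) ∣ c i - 1) ∧
      h₀.coeff 0 ≠ 0 ∧ h₀.coeff 0 * ∏ i, (-c i) = 2 ^ (h₀.coeff 0).valuation := by
  obtain ⟨y₀, s₀, hy₀, hys, hgen⟩ := exists_generator_sq_class 2 w hc ι hm
  obtain ⟨y, s, h₀, hy, hys', hgen', hm₀, hdeg, hmap, hlow⟩ := exists_scaled_generator 2 hy₀ hys hgen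
  -- `h₀(0) ≠ 0`: it maps to the constant coefficient of `minpoly y`, and `y ≠ 0`
  have h00 : h₀.coeff 0 ≠ 0 := by
    intro h0
    have : (minpoly ℚ_[2] y).coeff 0 = 0 := by rw [← hmap, coeff_map, h0, map_zero]
    exact minpoly.coeff_zero_ne_zero (IsIntegral.of_finite ℚ_[2] y) hy this
  -- `d₀ ≥ 1`
  have hd₀ : 1 ≤ h₀.natDegree := by rw [hdeg]; exact Module.finrank_pos
  obtain ⟨r, c, hr1, hr3, hd, hcu, hci, hc1, hc4, hprod⟩ := exists_units_mul_prod_neg_eq_one_two (PadicInt.unitCoeff h00) hd₀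
  refine ⟨y, s, h₀, r, c, hy, hys', hgen', hm₀, hdeg, hmap, hlow, fun u hu => not_isRoot_of_isUnit_of_coeff_norm_lt_one 2 hm₀ hlow hu,
    hr1, hr3, hd, hcu, hci, hc1, hc4, h00, ?_⟩
  have hspec := PadicInt.unitCoeff_spec h00
  have key : h₀.coeff 0 * ∏ i, (-c i) = (2 : ℤ_[2]) ^ (h₀.coeff 0).valuation * ((PadicInt.unitCoeff h00 : ℤ_[2]) * ∏ i, (-c i)) := by
    nth_rw 1 [hspec]
    push_cast
    ring
  rw [key, hprod, mul_one]

end Datum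

end Summit.HodgeConjecture.HodgeConjecture.R90.S3

end
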